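import Summits.CriticalPhenomena.SAWScalingLimit.Theorems.SAWLeftRightFKGFKGToTraversalBoundOutlineAbab
import Literature.Probability.LatticeModels.RandomClusterBoxDuality
import HarnessLib

/-!
# Shared boundary edges of nested site sets appear in the same order on both tours (witness unit U6a)

Crux `SAWLeftRightFKG.FKGToTraversalBound` (stmt-CriticalPhenomena-1878), line `slit-necklace`, lead
prover-line-stmt-CriticalPhenomena-1878-c5-0; witness unit U6a, on top of the vocabulary `…SlitNecklaceOutline`
(`IsBEdge`, `bsite`, `bcontact`, `btour`), `…OutlineFaces` (`cornerFace`, the wall-follower tour as a walk of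
faces) and `…OutlineAbab` (`abab_walkWinding_ne_of_sepEdge_mem`, the jump of the winding number across a used
edge).

Registered stub `btour_shared_order`.  Abstract lattice statement: `A ⊆ B ⊆ ℤ²` finite, `A` `4`-connected, the
complement of `B` `4`-connected; `e` a boundary edge of `A` whose contact site is even outside `B` (a SHARED
boundary edge: it is a boundary edge of `B` too); the `A`-tour from `e` has first return time `NA` and the `B`-tour
from `e` first return time `NB` (no repeats before).  If the `A`-positions `0 < p₂ < p₃ < NA` carry shared edges,
met by the `B`-tour at positions `l₂, l₃ ∈ (0, NB)`, then `l₂ < l₃`: both tours meet the shared edges in the same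
cyclic order.

Proof (discrete planar topology by the tree's combinatorial winding number `walkWinding`, no Jordan curve
theorem; same template as `btour_abab` / `btour_rootSide_dichotomy`).  `l₂ = l₃` contradicts the injectivity of
the `A`-tour; suppose `l₃ < l₂`.  Close an `A`-walk from `bsite e` to the outline site of `e₃ := btour A e p₃`
and a `Bᶜ`-walk from `bcontact e₃` back to `bcontact e` (both replaced by paths, `Walk.bypass`) with the two
shared edges into a closed lattice TRAIL `Ψ`.  An edge of `Ψ` from a site of `B` to a site outside `A` is one of
the two shared edges (`α`-edges join sites of `A`, `κ`-edges join sites outside `B`).  The faces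
`cornerFace (btour A e j)` and `cornerFace (btour B e j)` form face walks whose `j`-th step crosses exactly the
primal edge `{bsite, bcontact}` of position `j` (`sepEdge_cornerFace`), an edge from `A ⊆ B` to `Aᶜ`, resp. from
`B` to `Bᶜ ⊆ Aᶜ`; so `walkWinding Ψ` is constant along the `A`-arc `[1, p₃]` and along the `B`-arc `[l₃ + 1, NB]`
(`walkWinding_closed_eq_of_adj`, injectivity of the two tours), while it JUMPS across the shared edge `e`
(`abab_walkWinding_ne_of_sepEdge_mem`).  But `cornerFace (btour B e NB) = cornerFace e`,
`cornerFace (btour B e l₂) = cornerFace (btour A e p₂)` and `cornerFace (btour A e 1) = cornerFace e + vec (ccw d)`: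
under `l₃ < l₂` the two faces of the shared edge `e` would carry the same winding number — contradiction.

All statements folklore (boundary tracing of a polyomino; discrete winding numbers, Kesten, *Percolation theory
for mathematicians* (1982), §2.2, already formalised in `PlanarDuality.lean` / `RandomClusterBoxDuality.lean`);
no literature fact is introduced; nothing restates the crux.
-/

noncomputable section

open Set
open Literature.Probability.LatticeModels Literature.Probability.Percolation

namespace Summit.CriticalPhenomena.SAWScalingLimit.Theorems.FKGToTraversalBound.SlitNecklace

/-! ### Small bookkeeping -/

/-- A boundary edge is determined by its outline site and its contact site (a direction is determined by its
unit vector). [folklore] -/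
private theorem shared_eq_of_bsite_eq {e e' : Site 2 × ODir} (h₁ : bsite e = bsite e')
    (h₂ : bcontact e = bcontact e') : e = e' := by
  obtain ⟨x, d⟩ := e
  obtain ⟨x', d'⟩ := e'
  simp only [bsite] at h₁
  subst h₁
  simp only [bcontact, add_right_inj] at h₂
  have h0 := congrFun h₂ 0
  have h1 := congrFun h₂ 1
  fin_cases d <;> fin_cases d' <;> simp [ODir.vec] at h0 h1 ⊢

/-- The face step of a boundary edge crosses its primal edge `{bsite, bcontact}` (`sepEdge_cornerFace` for a
pair not in constructor form). [folklore] -/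
private theorem shared_sepEdge_cornerFace (e : Site 2 × ODir) :
    sepEdge (cornerFace e) (cornerFace e + e.2.ccw.vec) = s(bsite e, bcontact e) := by
  obtain ⟨x, d⟩ := e
  exact sepEdge_cornerFace x d

/-! ### Winding numbers of a closed trail about the tour faces -/

/-- **Constancy along a tour arc.** If the closed walk `p` uses none of the primal edges of the tour positions
`i ≤ j < i + m`, it winds equally about the tour faces `cornerFace (btour A e₀ i)` and
`cornerFace (btour A e₀ (i + m))` (the tour is a face walk crossing exactly those edges). [folklore] -/
private theorem shared_walkWinding_arc {a : Site 2} (p : (zdGraph 2).Walk a a) (A : Set (Site 2))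
    (e₀ : Site 2 × ODir) {i : ℕ} :
    ∀ {m : ℕ}, (∀ j, i ≤ j → j < i + m → s(bsite (btour A e₀ j), bcontact (btour A e₀ j)) ∉ p.edges) →
      walkWinding p (cornerFace (btour A e₀ (i + m))) = walkWinding p (cornerFace (btour A e₀ i)) := by
  intro m
  induction m with
  | zero => intro; rfl
  | succ m ih =>
    intro h
    rw [← add_assoc, cornerFace_btour_succ,
      ← walkWinding_closed_eq_of_adj (adj_cornerFace_add (btour A e₀ (i + m))) ?_]
    · exact ih fun j hj hj' => h j hj (by omega)
    · rw [shared_sepEdge_cornerFace]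
      exact h (i + m) le_self_add (by omega)

/-- **Core of the order lemma**, for an abstract closed lattice trail `p` through the shared edge `e`, through
no primal edge of the `A`-tour positions `0 < j < p₃` and through no primal edge of the `B`-tour positions
`l₃ < j < NB`: a common edge of the two tours at `A`-position `p₂ ∈ (0, p₃]` and `B`-position `l₂ ∈ (l₃, NB]`
is impossible (the two faces of `e` would carry the same winding number). [folklore] -/
private theorem shared_core {a : Site 2} (p : (zdGraph 2).Walk a a) (hp : p.edges.Nodup)
    (A B : Set (Site 2)) (e : Site 2 × ODir) {NB p₂ p₃ l₂ l₃ : ℕ} (hNB : btour B e NB = e)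
    (h0 : s(bsite e, bcontact e) ∈ p.edges)
    (hsepA : ∀ j, 0 < j → j < p₃ → s(bsite (btour A e j), bcontact (btour A e j)) ∉ p.edges)
    (hsepB : ∀ j, l₃ < j → j < NB → s(bsite (btour B e j), bcontact (btour B e j)) ∉ p.edges)
    (h02 : 0 < p₂) (h23 : p₂ ≤ p₃) (h32 : l₃ < l₂) (h2N : l₂ ≤ NB)
    (h22 : btour B e l₂ = btour A e p₂) : False := by
  -- the `A`-arc `[1, p₂]` carries the value of `cornerFace (btour A e 1)`
  obtain ⟨m, rfl⟩ : ∃ m, p₂ = 1 + m := ⟨p₂ - 1, by omega⟩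
  have harcA : walkWinding p (cornerFace (btour A e (1 + m))) = walkWinding p (cornerFace (btour A e 1)) :=
    shared_walkWinding_arc p A e fun j hj hj' => hsepA j (by omega) (by omega)
  -- the `B`-arc `[l₃ + 1, NB]` carries the value of `cornerFace (btour B e NB) = cornerFace e`
  obtain ⟨m₂, rfl⟩ : ∃ m₂, l₂ = l₃ + 1 + m₂ := ⟨l₂ - (l₃ + 1), by omega⟩
  have harcB₁ : walkWinding p (cornerFace (btour B e (l₃ + 1 + m₂))) =
      walkWinding p (cornerFace (btour B e (l₃ + 1))) :=
    shared_walkWinding_arc p B e fun j hj hj' => hsepB j (by omega) (by omega)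
  obtain ⟨m₃, rfl⟩ : ∃ m₃, NB = l₃ + 1 + m₃ := ⟨NB - (l₃ + 1), by omega⟩
  have harcB₂ : walkWinding p (cornerFace (btour B e (l₃ + 1 + m₃))) =
      walkWinding p (cornerFace (btour B e (l₃ + 1))) :=
    shared_walkWinding_arc p B e fun j hj hj' => hsepB j (by omega) hj'
  rw [hNB] at harcB₂
  -- the jump across the shared edge `e`
  have hF1 : cornerFace (btour A e 1) = cornerFace e + e.2.ccw.vec := by
    simpa using cornerFace_btour_succ A e 0
  have hjump : walkWinding p (cornerFace e) ≠ walkWinding p (cornerFace (btour A e 1)) := by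
    rw [hF1]
    refine abab_walkWinding_ne_of_sepEdge_mem hp (adj_cornerFace_add e) ?_
    rw [shared_sepEdge_cornerFace]
    exact h0
  exact hjump (by rw [harcB₂, ← harcB₁, h22, harcA])

/-! ### The closed trail through the two shared edges -/

/-- **The loop.**  From an `A`-walk joining the outline sites of two distinct boundary edges `e`, `e₃` of `A`
whose contacts lie outside `B ⊇ A`, and a walk outside `B` joining their contacts, a closed lattice TRAIL `Ψ`
at `bcontact e` through the primal edge of `e`, whose only edges from a site of `B` to a site outside `A` are the
primal edges of `e` and `e₃`. [folklore] -/
private theorem shared_loop {A B : Set (Site 2)} (hAB : A ⊆ B) {e e₃ : Site 2 × ODir} (he : IsBEdge A e)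
    (hc₁ : bcontact e ∉ B) (he₃ : IsBEdge A e₃) (hc₃ : bcontact e₃ ∉ B) (hne : e ≠ e₃)
    (α : (zdGraph 2).Walk (bsite e) (bsite e₃)) (hα : ∀ z ∈ α.support, z ∈ A)
    (κ : (zdGraph 2).Walk (bcontact e₃) (bcontact e)) (hκ : ∀ z ∈ κ.support, z ∉ B) :
    ∃ Ψ : (zdGraph 2).Walk (bcontact e) (bcontact e),
      Ψ.edges.Nodup ∧ s(bsite e, bcontact e) ∈ Ψ.edges ∧
      ∀ e' : Site 2 × ODir, bsite e' ∈ B → bcontact e' ∉ A → s(bsite e', bcontact e') ∈ Ψ.edges →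
        e' = e ∨ e' = e₃ := by
  classical
  have he' := bcontact_spec A he
  have he₃' := bcontact_spec A he₃
  have hαA : ∀ z ∈ α.bypass.support, z ∈ A := fun z hz => hα z (α.support_bypass_subset_support hz)
  have hκB : ∀ z ∈ κ.bypass.support, z ∉ B := fun z hz => hκ z (κ.support_bypass_subset_support hz)
  -- the closed walk through the two shared edges
  set Ψ : (zdGraph 2).Walk (bcontact e) (bcontact e) :=
    SimpleGraph.Walk.cons he'.2.2.symm (α.bypass.append (SimpleGraph.Walk.cons he₃'.2.2 κ.bypass)) with hΨ
  have hΨe : ∀ s ∈ Ψ.edges, s = s(bcontact e, bsite e) ∨ s ∈ α.bypass.edges ∨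
      s = s(bsite e₃, bcontact e₃) ∨ s ∈ κ.bypass.edges := by
    intro s hs
    simp only [hΨ, SimpleGraph.Walk.edges_cons, SimpleGraph.Walk.edges_append, List.mem_cons,
      List.mem_append] at hs
    tauto
  -- the two shared edges differ
  have htip : s(bcontact e, bsite e) ≠ s(bsite e₃, bcontact e₃) := by
    intro h
    rcases Sym2.eq_iff.1 h with ⟨h1, -⟩ | ⟨h1, h2⟩
    · exact he'.2.1 (h1 ▸ he₃'.1)
    · exact hne (shared_eq_of_bsite_eq h2 h1)
  refine ⟨Ψ, ?_, ?_, ?_⟩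
  · -- `Ψ` is a trail
    rw [hΨ, SimpleGraph.Walk.edges_cons, List.nodup_cons, SimpleGraph.Walk.edges_append,
      SimpleGraph.Walk.edges_cons]
    refine ⟨fun h => ?_, List.nodup_append.2 ⟨α.bypass_isPath.isTrail.edges_nodup,
      List.nodup_cons.2 ⟨fun h => ?_, κ.bypass_isPath.isTrail.edges_nodup⟩, ?_⟩⟩
    · rcases List.mem_append.1 h with h | h
      · exact he'.2.1 (hαA _ (α.bypass.fst_mem_support_of_mem_edges h))
      · rcases List.mem_cons.1 h with h | h
        · exact htip h
        · exact hκB _ (κ.bypass.snd_mem_support_of_mem_edges h) (hAB he'.1)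
    · exact hκB _ (κ.bypass.fst_mem_support_of_mem_edges h) (hAB he₃'.1)
    · rintro s hs _ hs' rfl
      rcases List.mem_cons.1 hs' with rfl | hs'
      · exact he₃'.2.1 (hαA _ (α.bypass.snd_mem_support_of_mem_edges hs))
      · induction s using Sym2.ind with
        | _ u v =>
          exact hκB u (κ.bypass.fst_mem_support_of_mem_edges hs')
            (hAB (hαA u (α.bypass.fst_mem_support_of_mem_edges hs)))
  · -- `Ψ` uses the shared edge `e`
    rw [hΨ, SimpleGraph.Walk.edges_cons, Sym2.eq_swap]
    exact List.mem_cons_self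
  · -- the `B`–`Aᶜ` edges of `Ψ`
    intro e' hb hc hmem
    rcases hΨe _ hmem with h | h | h | h
    · rcases Sym2.eq_iff.1 h with ⟨h1, -⟩ | ⟨h1, h2⟩
      · exact absurd (h1 ▸ hb) hc₁
      · exact Or.inl (shared_eq_of_bsite_eq h1 h2)
    · exact absurd (hαA _ (α.bypass.snd_mem_support_of_mem_edges h)) hc
    · rcases Sym2.eq_iff.1 h with ⟨h1, h2⟩ | ⟨h1, -⟩
      · exact Or.inr (shared_eq_of_bsite_eq h1 h2)
      · exact absurd (h1 ▸ hb) hc₃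
    · exact absurd hb (hκB _ (κ.bypass.fst_mem_support_of_mem_edges h))

/-! ### The registered stub -/

/-- **Registered stub (witness unit U6a): shared boundary edges of nested site sets appear in the same order on
both wall-follower tours.**  `A ⊆ B` (`A` `4`-connected, `ℤ² ∖ B` `4`-connected), `e` a boundary edge of `A` with
contact outside `B`, both tours cut at `e`; shared edges at `A`-positions `0 < p₂ < p₃ < NA` and `B`-positions
`l₂, l₃ ∈ (0, NB)` satisfy `l₂ < l₃`.  Proof: `l₂ = l₃` contradicts the injectivity of the `A`-tour; `l₃ < l₂` is
excluded by `shared_core` applied to the closed trail `shared_loop` through the two shared edges `e` and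
`btour A e p₃`. [folklore] -/
theorem btour_shared_order : ∀ (A B : Finset (Site 2)) (e : Site 2 × ODir) (NA NB p₂ p₃ l₂ l₃ : ℕ), A ⊆ B → (∀ x ∈ A, ∀ y ∈ A, ∃ w : (zdGraph 2).Walk x y, ∀ z ∈ w.support, z ∈ A) → (∀ x y : Site 2, x ∉ B → y ∉ B → ∃ w : (zdGraph 2).Walk x y, ∀ z ∈ w.support, z ∉ B) → IsBEdge (↑A : Set (Site 2)) e → bcontact e ∉ B → btour (↑A : Set (Site 2)) e NA = e → (∀ j j', j < NA → j' < NA → btour (↑A : Set (Site 2)) e j = btour (↑A : Set (Site 2)) e j' → j = j') → btour (↑B : Set (Site 2)) e NB = e → (∀ j j', j < NB → j' < NB → btour (↑B : Set (Site 2)) e j = btour (↑B : Set (Site 2)) e j' → j = j') → 0 < p₂ → p₂ < p₃ → p₃ < NA → 0 < l₂ → l₂ < NB → 0 < l₃ → l₃ < NB → btour (↑B : Set (Site 2)) e l₂ = btour (↑A : Set (Site 2)) e p₂ → btour (↑B : Set (Site 2)) e l₃ = btour (↑A : Set (Site 2)) e p₃ → bcontact (btour (↑A : Set (Site 2)) e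 p₂) ∉ B → bcontact (btour (↑A : Set (Site 2)) e p₃) ∉ B → l₂ < l₃ := by
  classical
  intro A B e NA NB p₂ p₃ l₂ l₃ hAB hA hBc he hc₁ _ hinjA hNB hinjB h02 h23 h3N _ hl₂N _ hl₃N h22 h33 _ hc₃
  rcases lt_trichotomy l₂ l₃ with h | rfl | h
  · exact h
  · -- `l₂ = l₃`: the two shared edges coincide, against the injectivity of the `A`-tour
    exfalso
    have := hinjA p₂ p₃ (by omega) h3N (h22.symm.trans h33)
    omega
  · -- `l₃ < l₂`: the winding-number contradiction
    exfalso
    have hAB' : (↑A : Set (Site 2)) ⊆ (↑B : Set (Site 2)) := Finset.coe_subset.2 hAB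
    have he' := bcontact_spec _ he
    have he₃ : IsBEdge (↑A : Set (Site 2)) (btour (↑A : Set (Site 2)) e p₃) := btour_isBEdge _ he p₃
    have he₃' := bcontact_spec _ he₃
    have heB : IsBEdge (↑B : Set (Site 2)) e := ⟨hAB' he'.1, hc₁⟩
    have hne : e ≠ btour (↑A : Set (Site 2)) e p₃ := fun h => by
      have := hinjA 0 p₃ (by omega) h3N (by rw [btour_zero]; exact h)
      omega
    obtain ⟨α, hα⟩ := hA (bsite e) he'.1 (bsite (btour (↑A : Set (Site 2)) e p₃)) he₃'.1
    obtain ⟨κ, hκ⟩ := hBc (bcontact (btour (↑A : Set (Site 2)) e p₃)) (bcontact e) hc₃ hc₁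
    obtain ⟨Ψ, hΨn, hΨ0, hΨe⟩ :=
      shared_loop hAB' he hc₁ he₃ hc₃ hne α (fun z hz => hα z hz) κ (fun z hz => hκ z hz)
    refine shared_core Ψ hΨn (↑A : Set (Site 2)) (↑B : Set (Site 2)) e hNB hΨ0 ?_ ?_ h02 h23.le h hl₂N.le
      h22
    · -- the `A`-tour crosses `Ψ` only at positions `0` and `p₃`
      intro j hj0 hj3 hmem
      have hej := bcontact_spec _ (btour_isBEdge (↑A : Set (Site 2)) he j)
      rcases hΨe _ (hAB' hej.1) hej.2.1 hmem with h1 | h1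
      · have := hinjA j 0 (by omega) (by omega) (by rw [h1, btour_zero])
        omega
      · have := hinjA j p₃ (by omega) h3N h1
        omega
    · -- the `B`-tour crosses `Ψ` only at positions `0` and `l₃`
      intro j hj3 hjN hmem
      have hej := bcontact_spec _ (btour_isBEdge (↑B : Set (Site 2)) heB j)
      rcases hΨe _ hej.1 (fun h' => hej.2.1 (hAB' h')) hmem with h1 | h1
      · have := hinjB j 0 hjN (by omega) (by rw [h1, btour_zero])
        omega
      · have := hinjB j l₃ hjN hl₃N (by rw [h1, h33])
        omega

end Summit.CriticalPhenomena.SAWScalingLimit.Theorems.FKGToTraversalBound.SlitNecklace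

end
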